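import Summits.CriticalPhenomena.SAWScalingLimit.Theorems.SAWDevelopingMapHexConjectureArcPhasesBound

/-!
# `stub_arcPhases` — arc phases of the truncated reflex wedge (crux `HexConjecture`, line `marginal-reflex-wedge-cauchy-kernel`)

Registered stub `stub_arcPhases` of the crux skeleton for `HexConjecture` (stmt-CriticalPhenomena-0808,
Duminil-Copin–Smirnov 2012 Conjecture 1: critical hexagonal-lattice SAW ⇒ chordal SLE(8/3)), line
`marginal-reflex-wedge-cauchy-kernel` (objects file `SAWDevelopingMapHexConjectureMarginalWedgeDefs.lean`): for
every ARC dart `(v, w)` of the truncated `300°` wedge `Λ = W_N`, `N ≥ 1` (`v ∈ Λ`, `w ∉ Λ` adjacent,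
`N ≤ ‖c_w‖`), the direction `c_w - c_v = e^{iθ}/√3` of the dart has a representative `θ ∈ [-11π/6, π/6]` such
that EVERY self-avoiding walk of `Λ` from the corner mid-edge `cornerEdge` to `s(v, w)` has winding `θ + π/2` —
the hypothesis of `arcMass_le_of_arcPhases` (`…ReflexCellCeilingArc.lean`), which turns it into the arc ceiling
`Σ_arc Zm ≤ 1 + √2` of the line's two-sided cell.

## Proof (parts 1–2: `…ArcPhasesCut.lean`, `…ArcPhasesBound.lean`; this file: namespace `…MarginalWedge.ArcPhase`)

No explicit walk is used. For an ARBITRARY walk `γ` to the dart, **`winding_eq_args`** evaluates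
`W_γ = arg(w̄ (c_w - c_v)) - arg(w̄ (c_w - o)) + arg(ō (o - c_w)) - π/3` (`o = c(cornerOut) = e^{iπ/6}/√3`,
`w̄ = conj c_w`): the winding is `(π/3)·pturn` of the code of the walk under the chart `hvIso.trans flip`
(`HexMidEdgeSAW.winding_eq_pturn_code`, `HexSAWPathRigidity.lean`), which the discrete Hopf Umlaufsatz
`HV.hopf_path` (`HexSAWHopfPath.lean`) splits into the angle swept by the secant into the end plus the angle
swept by the secant from the start. END: the walk and `o` lie in the open disc of radius `‖c_w‖`, so the secants
`w̄ (c_w - ·)` have positive real part (`sum_toReal_argDiff_of_re_pos`). START: the polyline of the walk never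
meets the cut ray `{t·o : t ≥ 1}` (`arcPhase_segment_avoids_cut`), so in the frame `ō (o - ·)` every increment is
a plain difference of arguments (`toReal_argDiff_of_segment`) and the sweep telescopes; the first secant
`ō (o - c_in) = e^{iπ/3}/3` has argument `π/3` (`arg_firstSecant`). Then `θ := W - π/2` works: the bound
`θ ∈ [-11π/6, π/6]` is `arcPhase_bound`, and `e^{iθ} = √3 (c_w - c_v)` because modulo `2π` the three arguments
combine to `arg(c_w - c_v) + 5π/6` (`dart_eq_exp`). Folklore; no named fact is used.
-/

open scoped BigOperators Classical
open Literature.Probability.LatticeModels Literature.Probability.RandomPlanarGeometry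
  Literature.Probability.RandomPlanarGeometry.SAW Literature.Probability.RandomPlanarGeometry.SAW.HV

namespace Summit.CriticalPhenomena.SAWScalingLimit.Theorems.HexConjecture.MarginalWedge.ArcPhase

open ReflexGeometry Hopf

/-! ### The first secant and the dart direction -/

/-- The first secant from `o` points down: `ō (o - c_in) = (1/3) e^{iπ/3}` has argument `π/3`. [folklore] -/
theorem arg_firstSecant :
    Complex.arg ((starRingEnd ℂ) (hexCenter cornerOut) * (hexCenter cornerOut - hexCenter cornerIn)) = Real.pi / 3 := by
  have h3 : Real.sqrt 3 * Real.sqrt 3 = 3 := Real.mul_self_sqrt (by norm_num)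
  have key : (starRingEnd ℂ) (hexCenter cornerOut) * (hexCenter cornerOut - hexCenter cornerIn) =
      ((1 / 3 : ℝ) : ℂ) * (Complex.cos ((Real.pi / 3 : ℝ) : ℂ) + Complex.sin ((Real.pi / 3 : ℝ) : ℂ) * Complex.I) := by
    rw [← Complex.ofReal_cos, ← Complex.ofReal_sin, Real.cos_pi_div_three, Real.sin_pi_div_three]
    apply Complex.ext
    · simp only [Complex.mul_re, Complex.conj_re, Complex.conj_im, Complex.sub_re, Complex.sub_im, FluxLine.re_cornerOut,
        FluxLine.im_cornerOut, FluxLine.re_cornerIn, FluxLine.im_cornerIn, Complex.add_re, Complex.ofReal_re, Complex.ofReal_im,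
        Complex.mul_im, Complex.I_re, Complex.I_im, Complex.add_im]
      nlinarith [h3]
    · simp only [Complex.mul_re, Complex.conj_re, Complex.conj_im, Complex.sub_re, Complex.sub_im, FluxLine.re_cornerOut,
        FluxLine.im_cornerOut, FluxLine.re_cornerIn, FluxLine.im_cornerIn, Complex.add_re, Complex.ofReal_re, Complex.ofReal_im,
        Complex.mul_im, Complex.I_re, Complex.I_im, Complex.add_im]
      ring
  rw [key]
  exact Complex.arg_mul_cos_add_sin_mul_I (by norm_num) ⟨by linarith [Real.pi_pos], by linarith [Real.pi_pos]⟩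

/-- **The dart direction from the three arguments**: modulo `2π`,
`arg(w̄ d) - arg(w̄(w - o)) + arg(ō(o - w)) - 5π/6 ≡ arg d` for the dart vector `d = c_w - c_v` (the
`w̄`'s cancel, `arg(o - w) ≡ arg(w - o) + π`, `arg ō = -π/6`), so that `d = e^{iθ}/√3` for this real
number `θ`. [folklore] -/
theorem dart_eq_exp {v w : HexVertex} (hadj : hexGraph.Adj v w) (hwo : hexCenter w ≠ hexCenter cornerOut)
    (hw0 : hexCenter w ≠ 0) :
    hexCenter w - hexCenter v = (((Real.sqrt 3)⁻¹ : ℝ) : ℂ) * Complex.exp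
      (((Complex.arg ((starRingEnd ℂ) (hexCenter w) * (hexCenter w - hexCenter v)) -
          Complex.arg ((starRingEnd ℂ) (hexCenter w) * (hexCenter w - hexCenter cornerOut)) +
          Complex.arg ((starRingEnd ℂ) (hexCenter cornerOut) * (hexCenter cornerOut - hexCenter w)) -
          5 * Real.pi / 6 : ℝ) : ℂ) * Complex.I) := by
  set p := hexCenter w with hp
  set o := hexCenter cornerOut with ho
  set d := p - hexCenter v with hd
  have hd0 : d ≠ 0 := sub_ne_zero.2 (hexCenter_ne_of_adj hadj).symm
  have hdn : ‖d‖ = (Real.sqrt 3)⁻¹ := norm_hexCenter_sub_of_adj hadj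
  have hpo : p - o ≠ 0 := sub_ne_zero.2 hwo
  have hop : o - p ≠ 0 := sub_ne_zero.2 (Ne.symm hwo)
  have hcp : (starRingEnd ℂ) p ≠ 0 := (map_ne_zero _).2 hw0
  have hco : (starRingEnd ℂ) o ≠ 0 := (map_ne_zero _).2 cornerOut_ne_zero
  set θ : ℝ := Complex.arg ((starRingEnd ℂ) p * d) - Complex.arg ((starRingEnd ℂ) p * (p - o)) +
    Complex.arg ((starRingEnd ℂ) o * (o - p)) - 5 * Real.pi / 6 with hθ
  have hA : (θ : Real.Angle) = (Complex.arg d : Real.Angle) := by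
    have e1 := Complex.arg_mul_coe_angle hcp hd0
    have e2 := Complex.arg_mul_coe_angle hcp hpo
    have e3 := Complex.arg_mul_coe_angle hco hop
    have e4 : (Complex.arg (o - p) : Real.Angle) = Complex.arg (p - o) + Real.pi := by
      rw [show o - p = -(p - o) by ring, Complex.arg_neg_coe_angle hpo]
    have e5 : (Complex.arg ((starRingEnd ℂ) o) : Real.Angle) = -((Real.pi / 6 : ℝ) : Real.Angle) := by
      rw [Complex.arg_conj_coe_angle, ho, arg_cornerOut]
    rw [hθ, Real.Angle.coe_sub, Real.Angle.coe_add, Real.Angle.coe_sub, e1, e2, e3, e4, e5]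
    have : ((5 * Real.pi / 6 : ℝ) : Real.Angle) = (Real.pi : Real.Angle) - ((Real.pi / 6 : ℝ) : Real.Angle) := by
      rw [← Real.Angle.coe_sub]
      congr 1
      ring
    rw [this]
    abel
  obtain ⟨k, hk⟩ := Real.Angle.angle_eq_iff_two_pi_dvd_sub.1 hA
  have hθk : θ = Complex.arg d + 2 * Real.pi * k := by linarith
  have hexp : Complex.exp ((θ : ℂ) * Complex.I) = Complex.exp ((Complex.arg d : ℂ) * Complex.I) := by
    rw [hθk]
    push_cast
    rw [show ((Complex.arg d : ℂ) + 2 * (Real.pi : ℂ) * (k : ℂ)) * Complex.I =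
        (Complex.arg d : ℂ) * Complex.I + (k : ℂ) * (2 * (Real.pi : ℂ) * Complex.I) by ring,
      Complex.exp_add, Complex.exp_int_mul_two_pi_mul_I, mul_one]
  rw [hexp, exp_arg_mul_I_eq_div_norm hd0, hdn]
  have hs : ((Real.sqrt 3)⁻¹ : ℝ) ≠ 0 := inv_ne_zero (by positivity)
  have hs' : (((Real.sqrt 3)⁻¹ : ℝ) : ℂ) ≠ 0 := by exact_mod_cast hs
  field_simp

/-- A face off the cut is not `cornerOut`; in the frame `ō(o - ·)` it is a nonzero vector. [folklore] -/
theorem conj_cornerOut_mul_sub_ne_zero {u : HexVertex} (hoff : u.1 0 ≠ u.1 1 ∨ u.1 0 < 0) :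
    (starRingEnd ℂ) (hexCenter cornerOut) * (hexCenter cornerOut - hexCenter u) ≠ 0 := by
  intro h
  rw [mul_sub, sub_eq_zero, conj_cornerOut_mul_self] at h
  have him : ((starRingEnd ℂ) (hexCenter cornerOut) * hexCenter u).im = 0 := by
    rw [← h, Complex.ofReal_im]
  have hre := re_conj_cornerOut_mul_neg hoff him
  rw [← h, Complex.ofReal_re] at hre
  norm_num at hre

/-- **Hopf's evaluation of the winding of a walk of `W_N` from the root to an arc dart `(v, w)`.** The winding
is `(π/3)·pturn` of the code of the walk (`HexMidEdgeSAW.winding_eq_pturn_code`, chart `hvIso.trans flip`,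
a similarity `z ↦ -3z + 3`), which the discrete Umlaufsatz `HV.hopf_path` splits into the angle swept by the
secant into the end `w` plus the angle swept by the secant from the start `o = c(cornerOut)`. END: all
vertices of the walk and `o` lie in the open disc of radius `‖c_w‖`, so the secants `w̄(c_w - ·)` have
positive real part and the sweep is `arg(w̄(c_w - c_v)) - arg(w̄(c_w - o))`. START: the polyline of the walk
(vertices off the cut, `offCut_of_mem`, `offCut_outer`; edges `arcPhase_segment_avoids_cut`) never meets the cut ray
`{t o : t ≥ 1}`, so in the frame `ō(o - ·)` each increment is a plain difference of arguments
(`toReal_argDiff_of_segment`) and the sweep telescopes to `arg(ō(o - c_w)) - arg(ō(o - c_in))`, the last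
argument being `π/3`. [folklore] -/
theorem winding_eq_args {Λ : Finset HexVertex} {N : ℝ} (hN : 1 ≤ N) (hW : IsReflexWedgeTruncation Λ N)
    {v w : HexVertex} (hv : v ∈ Λ) (hw : w ∉ Λ) (hadj : hexGraph.Adj v w) (harc : IsArcDart N v w)
    (γ : HexMidEdgeSAW Λ cornerEdge s(v, w)) :
    γ.winding = Complex.arg ((starRingEnd ℂ) (hexCenter w) * (hexCenter w - hexCenter v)) -
        Complex.arg ((starRingEnd ℂ) (hexCenter w) * (hexCenter w - hexCenter cornerOut)) +
        Complex.arg ((starRingEnd ℂ) (hexCenter cornerOut) * (hexCenter cornerOut - hexCenter w)) - Real.pi / 3 := by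
  obtain ⟨hin, hout, hadjc⟩ := reflexWedge_cornerDart Λ N hN hW
  have harc' : N ≤ ‖hexCenter w‖ := harc
  have hwo : w ≠ cornerOut := by
    rintro rfl
    exact absurd (lt_of_lt_of_le norm_cornerOut_lt_one hN) (not_lt.2 harc')
  have hne : γ.verts ≠ [] := by
    intro h
    have ha := γ.eq_of_nil h
    have hwm : w ∈ cornerEdge := by
      rw [ha]
      exact Sym2.mem_mk_right v w
    rw [cornerEdge, Sym2.mem_iff] at hwm
    rcases hwm with rfl | rfl
    · exact hw hin
    · exact hwo rfl
  have hlast : γ.verts.getLast hne = v := by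
    rcases γ.getLast_eq_or hne with h | h
    · exact h
    · exact absurd (h ▸ γ.subset _ (List.getLast_mem hne)) hw
  have ha : cornerEdge = s(cornerOut, cornerIn) := by rw [cornerEdge, Sym2.eq_swap]
  have hhead : γ.verts.head hne = cornerIn := γ.head_eq ha hout hne
  obtain ⟨rest, hrest⟩ : ∃ rest, γ.verts = cornerIn :: rest := by
    obtain ⟨x, rest, hx⟩ := List.exists_cons_of_ne_nil hne
    have hx' : x = cornerIn := by
      rw [← hhead]
      simp [hx]
    exact ⟨rest, hx'.symm ▸ hx⟩
  set Φ : hexGraph ≃g hvGraph := hvIso.trans HV.flip with hΦ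
  have hcode := γ.winding_eq_pturn_code (u := cornerOut) (w₁ := cornerIn) (Φ := Φ) ha hout chart_cornerOut
    chart_cornerIn hadj chart_affine (by norm_num) hne (e := w) (Or.inl ⟨hlast, rfl⟩)
  rw [hcode]
  -- the code `P = [wOut, hvOrigin, …, Φ v, Φ w]`
  set P : List HV := wOut :: (γ.verts.map Φ ++ [Φ w]) with hP
  set m : ℕ := γ.verts.length with hm
  have hlm : (γ.verts.map Φ).length = m := by rw [List.length_map]
  have hlen : P.length = m + 2 := by rw [hP]; simp [hlm]
  have hlne : γ.verts.map Φ ≠ [] := by simpa using hne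
  have hlh : (γ.verts.map Φ).head? = some hvOrigin := by rw [hrest, List.map_cons, List.head?_cons, chart_cornerIn]
  have hc : P.IsChain hvGraph.Adj :=
    (γ.isMidWalk_code Φ ha hout chart_cornerOut chart_cornerIn hadj hne (Or.inl ⟨hlast, rfl⟩)).1
  have hnd : P.Nodup := by
    rw [hP, List.nodup_cons, List.mem_append, List.mem_singleton, not_or]
    refine ⟨⟨fun h => hout ?_, fun h => hwo (Φ.injective ?_)⟩, ?_⟩
    · rw [← chart_cornerOut, List.mem_map] at h
      obtain ⟨y, hy, hyu⟩ := h
      exact Φ.injective hyu ▸ γ.subset y hy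
    · rw [chart_cornerOut]
      exact h.symm
    · refine List.Nodup.append (γ.nodup.map Φ.injective) (List.nodup_singleton _) ?_
      rw [List.disjoint_singleton]
      intro h
      rw [List.mem_map] at h
      obtain ⟨y, hy, hyu⟩ := h
      exact hw (Φ.injective hyu ▸ γ.subset y hy)
  rw [hopf_path hc hnd hlen]
  -- centres along the code
  set c : ℕ → ℂ := fun i => hexCenter (Φ.symm (P.getD i hvOrigin)) with hc_def
  have hemb : ∀ i, emb (pos (P.getD i hvOrigin)) = -3 * c i + 3 := by
    intro i
    have h := chart_affine (Φ.symm (P.getD i hvOrigin))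
    rw [RelIso.apply_symm_apply] at h
    rw [h]
    simp [hc_def, emb]
  have hedir : ∀ i j, edir (P.getD i hvOrigin) (P.getD j hvOrigin) = -3 * (c j - c i) := by
    intro i j
    rw [edir, emb_sub, hemb, hemb]
    ring
  have hc0 : c 0 = hexCenter cornerOut := by
    simp only [hc_def, hP, List.getD_cons_zero]
    rw [← chart_cornerOut, RelIso.symm_apply_apply]
  have hcm1 : c (m + 1) = hexCenter w := by
    simp only [hc_def]
    rw [hP, ← hlm, getD_walk_last, RelIso.symm_apply_apply]
  have hcm : c m = hexCenter v := by
    simp only [hc_def]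
    rw [hP, ← hlm, getD_walk_prev hlne, List.getLast_map, hlast, RelIso.symm_apply_apply]
  have hc1 : c 1 = hexCenter cornerIn := by
    simp only [hc_def]
    rw [hP, getD_walk_one hlh (Φ w), ← chart_cornerIn, RelIso.symm_apply_apply]
  have hmem : ∀ i, 1 ≤ i → i ≤ m → Φ.symm (P.getD i hvOrigin) ∈ γ.verts := by
    intro i h1 h2
    obtain ⟨j, rfl⟩ : ∃ j, i = j + 1 := ⟨i - 1, by omega⟩
    rw [getD_eq_getElem_of_lt (by omega)]
    simp only [hP, List.getElem_cons_succ]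
    rw [List.getElem_append_left (by rw [hlm]; omega), List.getElem_map, RelIso.symm_apply_apply]
    exact List.getElem_mem _
  have hsymm_last : Φ.symm (P.getD (m + 1) hvOrigin) = w := by
    rw [hP, ← hlm, getD_walk_last, RelIso.symm_apply_apply]
  have hadjP : ∀ i, i ≤ m → hexGraph.Adj (Φ.symm (P.getD i hvOrigin)) (Φ.symm (P.getD (i + 1) hvOrigin)) := by
    intro i hi
    rw [Φ.symm.map_rel_iff, getD_eq_getElem_of_lt (by omega), getD_eq_getElem_of_lt (by omega)]
    exact hc.getElem i (by omega)
  set p : ℂ := hexCenter w with hp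
  set o : ℂ := hexCenter cornerOut with ho
  have hp0 : p ≠ 0 := norm_pos_iff.1 (by linarith)
  have hcp : (starRingEnd ℂ) p ≠ 0 := (map_ne_zero _).2 hp0
  have hco : (starRingEnd ℂ) o ≠ 0 := (map_ne_zero _).2 cornerOut_ne_zero
  -- END sweep: into `w`, inside the open disc of radius `‖c_w‖`
  have hEnd : ∑ i ∈ Finset.range m,
      (((Complex.arg (edir (P.getD (i + 1) hvOrigin) (P.getD (m + 1) hvOrigin)) : Real.Angle) -
        (Complex.arg (edir (P.getD i hvOrigin) (P.getD (m + 1) hvOrigin)) : Real.Angle))).toReal =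
      Complex.arg ((starRingEnd ℂ) p * (p - c m)) - Complex.arg ((starRingEnd ℂ) p * (p - c 0)) := by
    set Zf : ℕ → ℂ := fun i => (starRingEnd ℂ) p * (p - c i) with hZf
    have hk : ∀ i, edir (P.getD i hvOrigin) (P.getD (m + 1) hvOrigin) = (-3 / (starRingEnd ℂ) p) * Zf i := by
      intro i
      rw [hedir, hcm1, hZf]
      field_simp
    have hk0 : (-3 / (starRingEnd ℂ) p) ≠ 0 := div_ne_zero (by norm_num) hcp
    have hZpos : ∀ i ≤ m, 0 < (Zf i).re := by
      intro i hi
      apply re_conj_mul_sub_pos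
      rcases Nat.eq_zero_or_pos i with rfl | hi1
      · rw [hc0]
        linarith [norm_cornerOut_lt_one]
      · exact lt_of_lt_of_le ((hW _).1 (γ.subset _ (hmem i hi1 hi))).1 harc'
    have hZne : ∀ i ≤ m, Zf i ≠ 0 := fun i hi h => by
      have := hZpos i hi
      rw [h] at this
      simp at this
    calc _ = ∑ i ∈ Finset.range m, (((Complex.arg (Zf (i + 1))) : Real.Angle) - (Complex.arg (Zf i) : Real.Angle)).toReal := by
          refine Finset.sum_congr rfl fun i hi => ?_
          rw [Finset.mem_range] at hi
          rw [hk, hk, argDiff_mul_mul hk0 (hZne _ (by omega)) (hZne _ (by omega))]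
      _ = _ := sum_toReal_argDiff_of_re_pos Zf m hZpos
  -- START sweep: from `o`, with the cut along the bisector ray
  have hStart : ∑ i ∈ Finset.range m,
      (((Complex.arg (edir (P.getD 0 hvOrigin) (P.getD (i + 2) hvOrigin)) : Real.Angle) -
        (Complex.arg (edir (P.getD 0 hvOrigin) (P.getD (i + 1) hvOrigin)) : Real.Angle))).toReal =
      Complex.arg ((starRingEnd ℂ) o * (o - c (m + 1))) - Complex.arg ((starRingEnd ℂ) o * (o - c 1)) := by
    set Yf : ℕ → ℂ := fun i => (starRingEnd ℂ) o * (o - c i) with hYf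
    have hk : ∀ i, edir (P.getD 0 hvOrigin) (P.getD i hvOrigin) = (3 / (starRingEnd ℂ) o) * Yf i := by
      intro i
      rw [hedir, hc0, hYf]
      field_simp
      ring
    have hk0 : (3 / (starRingEnd ℂ) o) ≠ 0 := div_ne_zero (by norm_num) hco
    have hoff : ∀ i, 1 ≤ i → i ≤ m + 1 →
        (Φ.symm (P.getD i hvOrigin)).1 0 ≠ (Φ.symm (P.getD i hvOrigin)).1 1 ∨ (Φ.symm (P.getD i hvOrigin)).1 0 < 0 := by
      intro i h1 h2
      rcases Nat.lt_or_ge i (m + 1) with h | h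
      · exact offCut_of_mem hW (γ.subset _ (hmem i h1 (by omega)))
      · obtain rfl : i = m + 1 := le_antisymm h2 h
        rw [hsymm_last]
        exact offCut_outer hN hW hv hadj harc
    have hYne : ∀ i, 1 ≤ i → i ≤ m + 1 → Yf i ≠ 0 := fun i h1 h2 =>
      conj_cornerOut_mul_sub_ne_zero (hoff i h1 h2)
    have hseg : ∀ i, 1 ≤ i → i ≤ m →
        (((Complex.arg (Yf (i + 1))) : Real.Angle) - (Complex.arg (Yf i) : Real.Angle)).toReal =
          Complex.arg (Yf (i + 1)) - Complex.arg (Yf i) := by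
      intro i h1 h2
      apply toReal_argDiff_of_segment
      intro s hs0 hs1
      have key := arcPhase_segment_avoids_cut (hadjP i h2) (hoff i h1 (by omega)) (hoff (i + 1) (by omega) (by omega)) s hs0 hs1
      have e : ((1 - s : ℝ) : ℂ) * Yf i + (s : ℂ) * Yf (i + 1) =
          (starRingEnd ℂ) o * (o - (((1 - s : ℝ) : ℂ) * c i + (s : ℂ) * c (i + 1))) := by
        simp only [hYf]
        push_cast
        ring
      rw [e]
      exact key
    calc _ = ∑ i ∈ Finset.range m, (Complex.arg (Yf (i + 1 + 1)) - Complex.arg (Yf (i + 1))) := by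
          refine Finset.sum_congr rfl fun i hi => ?_
          rw [Finset.mem_range] at hi
          rw [hk, hk, argDiff_mul_mul hk0 (hYne _ (by omega) (by omega)) (hYne _ (by omega) (by omega)),
            ← hseg (i + 1) (by omega) (by omega)]
      _ = _ := Finset.sum_range_sub (fun i => Complex.arg (Yf (i + 1))) m
  rw [hEnd, hStart, hcm, hc0, hcm1, hc1, arg_firstSecant]
  ring

end Summit.CriticalPhenomena.SAWScalingLimit.Theorems.HexConjecture.MarginalWedge.ArcPhase

namespace Summit.CriticalPhenomena.SAWScalingLimit.Theorems.HexConjecture.MarginalWedge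

open ArcPhase

/-- **Arc phases of the truncated reflex wedge** (registered stub `stub_arcPhases` of the crux skeleton for
`HexConjecture`, line `marginal-reflex-wedge-cauchy-kernel`): for every arc dart `(v, w)` of `W_N`, `N ≥ 1`, the
direction `c_w - c_v = e^{iθ}/√3` of the dart has a representative `θ ∈ [-11π/6, π/6]` such that EVERY
self-avoiding walk of `W_N` from the corner mid-edge to `s(v, w)` has winding `θ + π/2`. Proof: Hopf's evaluation
`ArcPhase.winding_eq_args` of the winding of an arbitrary walk, the phase bound `ArcPhase.arcPhase_bound`, and the
identification of the direction `ArcPhase.dart_eq_exp`. [folklore] -/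
theorem stub_arcPhases : ∀ (Λ : Finset HexVertex) (N : ℝ), 1 ≤ N → IsReflexWedgeTruncation Λ N → ∀ v w : HexVertex, v ∈ Λ → w ∉ Λ → hexGraph.Adj v w → IsArcDart N v w → ∃ θ : ℝ, -(11 * Real.pi / 6) ≤ θ ∧ θ ≤ Real.pi / 6 ∧ hexCenter w - hexCenter v = ((Real.sqrt 3)⁻¹ : ℝ) * Complex.exp (θ * Complex.I) ∧ ∀ γ : HexMidEdgeSAW Λ cornerEdge s(v, w), γ.winding = θ + Real.pi / 2 := by
  intro Λ N hN hW v w hv hw hadj harc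
  have harc' : N ≤ ‖hexCenter w‖ := harc
  have hw0 : hexCenter w ≠ 0 := norm_pos_iff.1 (by linarith)
  have hwo : hexCenter w ≠ hexCenter cornerOut := by
    intro h
    have := norm_cornerOut_lt_one
    rw [← h] at this
    linarith
  obtain ⟨h1, h2⟩ := arcPhase_bound hN hW hv hadj harc
  refine ⟨Complex.arg ((starRingEnd ℂ) (hexCenter w) * (hexCenter w - hexCenter v)) -
      Complex.arg ((starRingEnd ℂ) (hexCenter w) * (hexCenter w - hexCenter cornerOut)) +
      Complex.arg ((starRingEnd ℂ) (hexCenter cornerOut) * (hexCenter cornerOut - hexCenter w)) -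
      5 * Real.pi / 6, by linarith, by linarith, dart_eq_exp hadj hwo hw0, fun γ => ?_⟩
  rw [winding_eq_args hN hW hv hw hadj harc γ]
  ring

end Summit.CriticalPhenomena.SAWScalingLimit.Theorems.HexConjecture.MarginalWedge
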